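import Summits.AtomisticToContinuum.Crystallization.Theorems.ChartedZeroExcessLayeredLatticeLiouvilleZY

/-!
# Part ZZA «The combinatorial endgame, assembled: window dichotomy ⇒ affine layer law, after at most one re-slicing» (lens-2 g79, NODE 79 rider 10;
imports ZY)

One theorem packaging Parts ZV–ZY for the transverse endgame of (L2-C⟂′T).  INPUT (delivered by Part ZZ from the metric data): a map `g : ℤ³ → ℤ³` that
is a link map `B_τ → B_τ'` at every vertex of a window `W` and at every neighbour of `W` (`hmaps`, `hnb`), an inner window `W' ⊆ W` whose neighbours
lie in `W`, both Barlow-connected from a base vertex `y ∈ W'`.  OUTPUT (`exists_aut_layerLaw`): a re-indexing `φ` of the target — the identity, or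
(only when the target letters are CONSTANT `= b` on every layer the window reads) one of the three re-slicings `resliceInv b f` of Part ZX — and a
sign `s = ±1` such that on `W'` every vertex is cap-type for `φ ∘ g`, sheet neighbours keep their target layer, and the target layer is AFFINE in the
source sheet: `(φ (g x)).1 − s·x.1 = (φ (g y)).1 − s·y.1`.  Steps: `window_dichotomy` (ZW: all cap-type, or all-c), `layerLaw_of_capType` (ZY-5 with
`φ = id`), `letters_of_allC` + `toConst_window` (ZY-1: all-c ⇒ one letter `b` on the read range ⇒ link maps into `B_b` on `W'`), then ZY
`exists_reslice_layerLaw`.  0 sorry.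
-/

namespace Summit.AtomisticToContinuum.Crystallization.Theorems.ChartedZeroExcessLayeredLatticeLiouville

/-- in-window Barlow paths reverse. [formal bookkeeping] -/
theorem windowPath_symm {τ : ℤ → Bool} {W : Set (ℤ × ℤ × ℤ)} {a b : ℤ × ℤ × ℤ}
    (h : Relation.ReflTransGen (fun a b => a ∈ W ∧ b ∈ W ∧ BarlowAdj τ a b) a b) :
    Relation.ReflTransGen (fun a b => a ∈ W ∧ b ∈ W ∧ BarlowAdj τ a b) b a := by
  induction h with
  | refl => exact Relation.ReflTransGen.refl
  | tail _ hbc ih => exact Relation.ReflTransGen.head ⟨hbc.2.1, hbc.1, barlowAdj_symm hbc.2.2⟩ ih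

/-- ★ THE WINDOW DICHOTOMY (Part ZW, packaged): on a Barlow-connected window carrying link maps (on it and next to it) EITHER every vertex is cap-type
OR every image vertex is a c-vertex of the target. [this file, g79] -/
theorem window_dichotomy {τ τ' : ℤ → Bool} {g : ℤ × ℤ × ℤ → ℤ × ℤ × ℤ} {W : Set (ℤ × ℤ × ℤ)} (hmaps : ∀ z ∈ W, IsLinkMap τ τ' g z)
    (hnb : ∀ z ∈ W, ∀ i, IsLinkMap τ τ' g (linkPt τ z i)) {y : ℤ × ℤ × ℤ}
    (hconn : ∀ x ∈ W, Relation.ReflTransGen (fun a b => a ∈ W ∧ b ∈ W ∧ BarlowAdj τ a b) y x) :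
    (∀ x ∈ W, CapType τ g x) ∨ ∀ x ∈ W, τ' ((g x).1 - 1) = τ' (g x).1 := by
  by_cases hc : ∀ x ∈ W, CapType τ g x
  · exact Or.inl hc
  · right
    obtain ⟨x, hx, hxc⟩ : ∃ x ∈ W, ¬ CapType τ g x := by
      by_contra h'
      exact hc fun x hx => by by_contra hh; exact h' ⟨x, hx, hh⟩
    intro z hz
    exact allC_of_not_capType hmaps hnb hz ((windowPath_symm (hconn z hz)).trans (hconn x hx)) hxc

/-- ★ CAP BRANCH ⇒ AFFINE LAYER LAW for `g` itself (Part ZY-5 with `φ = id`). [this file, g79] -/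
theorem layerLaw_of_capType {τ τ' : ℤ → Bool} {g : ℤ × ℤ × ℤ → ℤ × ℤ × ℤ} {W : Set (ℤ × ℤ × ℤ)}
    (hmaps : ∀ z ∈ W, IsLinkMap τ τ' g z) (hcapW : ∀ z ∈ W, CapType τ g z) {y : ℤ × ℤ × ℤ} (hy : y ∈ W)
    (hconn : ∀ x ∈ W, Relation.ReflTransGen (fun a b => a ∈ W ∧ b ∈ W ∧ BarlowAdj τ a b) y x) :
    ∃ s : ℤ, (s = 1 ∨ s = -1) ∧ (∀ x ∈ W, UpSign τ g x s ∧ (g x).1 - s * x.1 = (g y).1 - s * y.1) ∧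
      ∀ x ∈ W, ∀ i : Fin 12, i.val < 6 → (g (linkPt τ x i)).1 = (g x).1 := by
  obtain ⟨s, hs01, hsy⟩ := (hcapW y hy).exists_upSign (hmaps y hy)
  exact ⟨s, hs01, fun x hx => ⟨hsy.of_reflTransGen hmaps hcapW (hconn x hx), layer_affine_of_reflTransGen hsy hmaps hcapW (hconn x hx)⟩,
    fun x hx i hi => (hcapW x hx).inLayer (hmaps x hx) i hi⟩

/-- ★ ALL-c BRANCH ⇒ ONE LETTER: the target letters equal `b := τ' (g y).1` on both layers read at every vertex of the window. [this file, g79] -/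
theorem letters_of_allC {τ τ' : ℤ → Bool} {g : ℤ × ℤ × ℤ → ℤ × ℤ × ℤ} {W : Set (ℤ × ℤ × ℤ)} (hmaps : ∀ z ∈ W, IsLinkMap τ τ' g z)
    (hallc : ∀ z ∈ W, τ' ((g z).1 - 1) = τ' (g z).1) {y : ℤ × ℤ × ℤ}
    (hconn : ∀ x ∈ W, Relation.ReflTransGen (fun a b => a ∈ W ∧ b ∈ W ∧ BarlowAdj τ a b) y x) :
    ∀ z ∈ W, τ' ((g z).1 - 1) = τ' (g y).1 ∧ τ' (g z).1 = τ' (g y).1 := fun z hz =>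
  have hb := letter_eq_of_reflTransGen hmaps hallc (hconn z hz)
  ⟨(hallc z hz).trans hb, hb⟩

/-- ★ … hence LINK MAPS INTO THE CONSTANT-LETTER GRAPH `B_b` on the inner window and at its neighbours (`IsLinkMap.toConst`).
[this file, g79] -/
theorem toConst_window {τ τ' : ℤ → Bool} {g : ℤ × ℤ × ℤ → ℤ × ℤ × ℤ} {W W' : Set (ℤ × ℤ × ℤ)} (hmaps : ∀ z ∈ W, IsLinkMap τ τ' g z)
    (hnb : ∀ z ∈ W, ∀ i, IsLinkMap τ τ' g (linkPt τ z i)) (hallc : ∀ z ∈ W, τ' ((g z).1 - 1) = τ' (g z).1) {y : ℤ × ℤ × ℤ}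
    (hconn : ∀ x ∈ W, Relation.ReflTransGen (fun a b => a ∈ W ∧ b ∈ W ∧ BarlowAdj τ a b) y x) (hW'W : W' ⊆ W)
    (hW'1 : ∀ z ∈ W', ∀ i, linkPt τ z i ∈ W) :
    (∀ z ∈ W', IsLinkMap τ (fun _ => τ' (g y).1) g z) ∧ ∀ z ∈ W', ∀ i, IsLinkMap τ (fun _ => τ' (g y).1) g (linkPt τ z i) := by
  have hb := letters_of_allC hmaps hallc hconn
  exact ⟨fun z hz => (hmaps z (hW'W hz)).toConst (hb z (hW'W hz)).1 (hb z (hW'W hz)).2,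
    fun z hz i => (hnb z (hW'W hz) i).toConst (hb _ (hW'1 z hz i)).1 (hb _ (hW'1 z hz i)).2⟩

/-- ★★★★ THE COMBINATORIAL ENDGAME OF (L2-C⟂′T): from link maps on a window to an AFFINE LAYER LAW after at most one re-slicing of the target.  `φ = id`
(cap branch, or all-c branch where the old slicing already fits) or `φ = resliceInv b f` with `b` THE letter of the target on the whole read range
(all-c branch); in the re-indexed chart `φ ∘ g` the source sheet `k` goes INTO the target sheet `L₀ + s·k`, `s = ±1`, on the inner window. [this file, g79] -/
theorem exists_aut_layerLaw {τ τ' : ℤ → Bool} {g : ℤ × ℤ × ℤ → ℤ × ℤ × ℤ} {W W' : Set (ℤ × ℤ × ℤ)}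
    (hmaps : ∀ z ∈ W, IsLinkMap τ τ' g z) (hnb : ∀ z ∈ W, ∀ i, IsLinkMap τ τ' g (linkPt τ z i)) (hW'W : W' ⊆ W)
    (hW'1 : ∀ z ∈ W', ∀ i, linkPt τ z i ∈ W) {y : ℤ × ℤ × ℤ} (hy : y ∈ W')
    (hconn : ∀ x ∈ W, Relation.ReflTransGen (fun a b => a ∈ W ∧ b ∈ W ∧ BarlowAdj τ a b) y x)
    (hconn' : ∀ x ∈ W', Relation.ReflTransGen (fun a b => a ∈ W' ∧ b ∈ W' ∧ BarlowAdj τ a b) y x) :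
    ∃ (φ : ℤ × ℤ × ℤ → ℤ × ℤ × ℤ) (s : ℤ),
      (φ = id ∨ ∃ (b : Bool) (f : Fin 3), (∀ z ∈ W, τ' ((g z).1 - 1) = b ∧ τ' (g z).1 = b) ∧ φ = resliceInv b f) ∧ (s = 1 ∨ s = -1) ∧
        (∀ x ∈ W', CapType τ (φ ∘ g) x ∧ UpSign τ (φ ∘ g) x s ∧ ((φ ∘ g) x).1 - s * x.1 = ((φ ∘ g) y).1 - s * y.1) ∧
          ∀ x ∈ W', ∀ i : Fin 12, i.val < 6 → ((φ ∘ g) (linkPt τ x i)).1 = ((φ ∘ g) x).1 := by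
  have hmaps' : ∀ z ∈ W', IsLinkMap τ τ' g z := fun z hz => hmaps z (hW'W hz)
  rcases window_dichotomy hmaps hnb hconn with hcap | hallc
  · have hcap' : ∀ z ∈ W', CapType τ g z := fun z hz => hcap z (hW'W hz)
    obtain ⟨s, hs01, hW, hin⟩ := layerLaw_of_capType hmaps' hcap' hy hconn'
    exact ⟨id, s, Or.inl rfl, hs01, fun x hx => ⟨hcap' x hx, hW x hx⟩, hin⟩
  · obtain ⟨hm, hn⟩ := toConst_window hmaps hnb hallc hconn hW'W hW'1
    obtain ⟨φ, hφ, s, hs01, hW, hin⟩ := exists_reslice_layerLaw hm hn hy hconn'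
    refine ⟨φ, s, ?_, hs01, hW, hin⟩
    rcases hφ with hφ | ⟨f, hφ⟩
    · exact Or.inl hφ
    · exact Or.inr ⟨τ' (g y).1, f, letters_of_allC hmaps hallc hconn, hφ⟩

end Summit.AtomisticToContinuum.Crystallization.Theorems.ChartedZeroExcessLayeredLatticeLiouville
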